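import Mathlib
import Summits.Ventures.HodgeRepro.Tier4.Common.CongruenceAdeles
import Summits.Ventures.HodgeRepro.Tier4.Common.CompactOpenLevel
import Summits.Ventures.HodgeRepro.Tier4.Line1.AdelicParts

/-!
# Tier4/Line4/ScaledBox — the compact box `{M ∈ M₄(𝔸_k) | M_∞ = 1, p^m M_f ∈ ∏_v 𝓞_v}` and the clearing of denominators at `v ∣ p`
(the adelic bookkeeping of C-L4-NONSPLIT-FINITE)

Blind re-derivation cell `pub-hodge-repro`, Tier 4 «prove the step» (README §9–§10), seat t4-L1-p2 (prover, LINE L1, gen 5;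
L4 service cut C-L4-NONSPLIT-FINITE, plan-4 g6 S15721, TAKEN S15722, statement S15764).  Tree path
`lean/Summits/Ventures/HodgeRepro/Tier4/Line4/ScaledBox.lean`.  Mathlib + typer-2's `Common/CongruenceAdeles` (`integralSet`,
`isCompact_integralSet`), `Common/CompactOpenLevel` (`finPart`, the `integralBox` pattern), L1's `AdelicParts` (`infM`).  No literature.

* `scaledIntegral k c = {x ∈ 𝔸_{k,f} | c · x ∈ ∏_v 𝓞_v}` (`c ∈ k`), **compact** for `c ≠ 0` (the image of typer-2's compact
  `integralSet` under multiplication by `c⁻¹`: `scaledIntegral_eq_image`, `isCompact_scaledIntegral`); membership placewise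
  (`mem_scaledIntegral_iff`, `finPart_mem_scaledIntegral_iff`).
* `scaledBox k c` — adelic `4 × 4` matrices with archimedean part `1` and finite entries in `scaledIntegral k c`; **compact**
  (Tychonoff, `isCompact_scaledBox`); `mem_scaledBox_of`.
* `exists_pow_mul_mem_of_norm_lt_one` / **`exists_pow_mul_entries_mem`** — at a place with `‖p‖_v < 1` a single power `p^m`
  clears the denominators of finitely many elements of `k` (the rational entries of the line projectors), monotonically in `m`.

Nothing here says anything about the status of the Hodge conjecture for CM abelian varieties, which is NOT proved
(HC_CM is NOT proved by anyone in this repository).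
-/

set_option autoImplicit false

noncomputable section

namespace Summit.Ventures.HodgeRepro.Tier4.Line4

open Summit.Ventures.HodgeRepro.Tier4 Summit.Ventures.HodgeRepro.Tier4.Common Summit.Ventures.HodgeRepro.Tier4.Line1
  NumberField IsDedekindDomain Matrix

open scoped NumberField Classical

/-! ## Part A — the scaled integral set and the scaled box (compact) -/

section Scaled

variable (k : Type) [Field k] [NumberField k]

/-- **The scaled integral set** `{x ∈ 𝔸_{k,f} | c · x ∈ ∏_v 𝓞_v}` (`c ∈ k`). -/
def scaledIntegral (c : k) : Set (FiniteAdeleRing (𝓞 k) k) :=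
  {x | algebraMap k (FiniteAdeleRing (𝓞 k) k) c * x ∈ integralSet k}

/-- Membership, placewise. -/
theorem mem_scaledIntegral_iff (c : k) (x : FiniteAdeleRing (𝓞 k) k) :
    x ∈ scaledIntegral k c ↔ ∀ v : HeightOneSpectrum (𝓞 k),
      ((c : k) : v.adicCompletion k) * x v ∈ v.adicCompletionIntegers k := Iff.rfl

/-- Membership of a finite part, placewise through `adComponentFin`. -/
theorem finPart_mem_scaledIntegral_iff (c : k) (x : Ad k) :
    finPart k x ∈ scaledIntegral k c ↔ ∀ v : HeightOneSpectrum (𝓞 k),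
      algebraMap k (v.adicCompletion k) c * adComponentFin k v x ∈ v.adicCompletionIntegers k := Iff.rfl

/-- The scaled integral set is the image of the integral set under multiplication by `c⁻¹`. -/
theorem scaledIntegral_eq_image {c : k} (hc : c ≠ 0) :
    scaledIntegral k c = (fun x => algebraMap k (FiniteAdeleRing (𝓞 k) k) c⁻¹ * x) '' integralSet k := by
  ext x
  constructor
  · intro hx
    refine ⟨algebraMap k (FiniteAdeleRing (𝓞 k) k) c * x, hx, ?_⟩
    show algebraMap k (FiniteAdeleRing (𝓞 k) k) c⁻¹ * (algebraMap k (FiniteAdeleRing (𝓞 k) k) c * x) = x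
    rw [← mul_assoc, ← map_mul, inv_mul_cancel₀ hc, map_one, one_mul]
  · rintro ⟨y, hy, rfl⟩
    show algebraMap k (FiniteAdeleRing (𝓞 k) k) c * (algebraMap k (FiniteAdeleRing (𝓞 k) k) c⁻¹ * y) ∈ integralSet k
    rw [← mul_assoc, ← map_mul, mul_inv_cancel₀ hc, map_one, one_mul]
    exact hy

/-- **The scaled integral set is compact** (a continuous image of typer-2's compact `integralSet`). -/
theorem isCompact_scaledIntegral {c : k} (hc : c ≠ 0) : IsCompact (scaledIntegral k c) := by
  rw [scaledIntegral_eq_image k hc]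
  exact (isCompact_integralSet k).image (continuous_const.mul continuous_id)

/-- **The scaled box**: adelic matrices with archimedean part `1` and finite entries in the scaled integral set. -/
def scaledBox (c : k) : Set (M4 k) :=
  Set.pi Set.univ fun i => Set.pi Set.univ fun j =>
    (({infPart k ((1 : M4 k) i j)} : Set (InfiniteAdeleRing k)) ×ˢ scaledIntegral k c : Set (Ad k))

/-- The scaled box is compact (Tychonoff). -/
theorem isCompact_scaledBox {c : k} (hc : c ≠ 0) : IsCompact (scaledBox k c) :=
  isCompact_univ_pi fun _ => isCompact_univ_pi fun _ => isCompact_singleton.prod (isCompact_scaledIntegral k hc)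

/-- Membership in the scaled box for a matrix with archimedean part `1`. -/
theorem mem_scaledBox_of {c : k} {A : M4 k} (hinf : infM k A = 1) (hfin : ∀ i j, finPart k (A i j) ∈ scaledIntegral k c) :
    A ∈ scaledBox k c := by
  refine Set.mem_univ_pi.2 fun i => Set.mem_univ_pi.2 fun j => ⟨?_, hfin i j⟩
  have h1 : infPart k (A i j) = (infM k A) i j := rfl
  have h2 : infPart k ((1 : M4 k) i j) = (infM k (1 : M4 k)) i j := rfl
  show infPart k (A i j) = infPart k ((1 : M4 k) i j)
  rw [h1, h2, hinf, infM_one]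

end Scaled

/-! ## Part B — powers of `p` clear the denominators of finitely many rational numbers at `v ∣ p` -/

section Clear

variable {k : Type} [Field k] [NumberField k] (v : HeightOneSpectrum (𝓞 k))

/-- For `‖p‖_v < 1`, every `c ∈ k` has `p^m c ∈ 𝓞_v` for large `m`, and the bound is monotone in `m`. -/
theorem exists_pow_mul_mem_of_norm_lt_one {p : ℕ} (hp : ‖((p : k) : v.adicCompletion k)‖ < 1) (c : k) :
    ∃ m : ℕ, ∀ m' : ℕ, m ≤ m' → ((p : k) : v.adicCompletion k) ^ m' * algebraMap k (v.adicCompletion k) c ∈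
      v.adicCompletionIntegers k := by
  have hp0 : 0 ≤ ‖((p : k) : v.adicCompletion k)‖ := norm_nonneg _
  obtain ⟨m, hm⟩ := exists_pow_lt_of_lt_one (inv_pos.2 (lt_of_lt_of_le zero_lt_one
    (le_max_left 1 ‖algebraMap k (v.adicCompletion k) c‖))) hp
  refine ⟨m, fun m' hm' => ?_⟩
  rw [HeightOneSpectrum.mem_adicCompletionIntegers, ← Valued.toNormedField.norm_le_one_iff, norm_mul, norm_pow]
  have h1 : ‖((p : k) : v.adicCompletion k)‖ ^ m' ≤ ‖((p : k) : v.adicCompletion k)‖ ^ m :=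
    pow_le_pow_of_le_one hp0 hp.le hm'
  have hR : 0 < max 1 ‖algebraMap k (v.adicCompletion k) c‖ := lt_of_lt_of_le zero_lt_one (le_max_left _ _)
  calc ‖((p : k) : v.adicCompletion k)‖ ^ m' * ‖algebraMap k (v.adicCompletion k) c‖
      ≤ (max 1 ‖algebraMap k (v.adicCompletion k) c‖)⁻¹ * max 1 ‖algebraMap k (v.adicCompletion k) c‖ := by
        gcongr
        · exact h1.trans hm.le
        · exact le_max_right _ _
    _ = 1 := inv_mul_cancel₀ hR.ne'

/-- A single `m` clears the denominators of all `16 · 2 · 2` rational entries of two pairs of matrices at once. -/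
theorem exists_pow_mul_entries_mem {p : ℕ} (hp : ‖((p : k) : v.adicCompletion k)‖ < 1)
    (A : Fin 4 → Matrix (Fin 4) (Fin 4) k) :
    ∃ m : ℕ, ∀ (l : Fin 4) (i j : Fin 4), ((p : k) : v.adicCompletion k) ^ m * algebraMap k (v.adicCompletion k) (A l i j) ∈
      v.adicCompletionIntegers k := by
  choose m hm using fun t : Fin 4 × Fin 4 × Fin 4 => exists_pow_mul_mem_of_norm_lt_one v hp (A t.1 t.2.1 t.2.2)
  refine ⟨Finset.univ.sup m, fun l i j => hm (l, i, j) _ (Finset.le_sup (Finset.mem_univ (l, i, j)))⟩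

end Clear


end Summit.Ventures.HodgeRepro.Tier4.Line4

end
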